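import Literature.Probability.LatticeModels.PlaneRotatorEnergyRenormalizedDecay
import Literature.MathematicalPhysics.StatisticalMechanics.KosterlitzThoulessStiffnessBound
import HarnessLib

/-!
# The helicity modulus (spin-wave stiffness) of the plane rotator in finite volume:
# Fisher–Barber–Jasnow's twist response, the f-sum bound `Υ ≤ J·⟨cos ∇θ⟩`, and the
# energy-renormalised Kosterlitz–Thouless bound `T_KT ≤ (√(16+4π) − 4)·J` for the XY model on `(ℤ/Lℤ)²`

Topic `Literature/Probability/LatticeModels`. For the plane rotator (classical XY model) with general
real bond couplings `J : ι → ℝ` on a finite bond system `G : BondSystem V ι` (spins `θ ∈ U(1)^V`, Haar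
probability measure, Gibbs weight `w_J = exp(∑_a J_a cos(θ_{tgt a} − θ_{src a}))`, vocabulary of
`DisorderedXYModel.lean` / `PlaneRotatorJensenRotationBound.lean`) we impose a **twist**: a phase
`t·s_a` on every bond (`s : ι → ℝ` the twist profile, `t ∈ ℝ` its amplitude),

  `Z(t) = ∫ exp(∑_a J_a cos(θ_{tgt a} − θ_{src a} + t s_a)) dθ`            (`twistPartitionFn`)

— the Garban–Spencer model with the quenched bond phases `u_a = e^{i t s_a}` (`weight_twistPhases`).
On the torus `(ℤ/Lℤ)²` with `s_a = 1` on the bonds along `e₁` and `0` on the others this is the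
twisted ensemble of M. E. Fisher, M. N. Barber, D. Jasnow, *Helicity modulus, superfluidity, and scaling
in isotropic systems*, Phys. Rev. A **8** (1973) 1111, §II: a uniform phase gradient `t` per lattice
spacing along `e₁` (gauge-equivalent to a twist `L·t` of the boundary condition around the `e₁`-cycle),
and the **helicity modulus** `Υ` is the second-order response of the free energy per site,
`F(t)/|Λ| = F(0)/|Λ| + ½ Υ t² + o(t²)`, `F = −β⁻¹ log Z` (ibid., eqs. (2.4)–(2.5); inverse temperature
absorbed in the couplings, `J_a = βJ`).

## Contents (everything PROVED; no named facts are introduced)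

* §1 `twistHamiltonian`, `twistWeight` and their `t`-derivatives; at `t = 0` the plane-rotator
  weight `w_J`; the bridge `weight_twistPhases` to the bond phases of `DisorderedXYModel.lean`; the
  inversion symmetry `θ ↦ θ̄` (weight even, twist current odd).
* §2 `twistPartitionFn` and **differentiation under the Haar integral, twice**:
  `hasDerivAt_twistPartitionFn` (`Z'(t) = ∫ ∂_t H_t · e^{H_t}`), `hasDerivAt_twistPartitionFnDeriv`
  (`Z''(t) = ∫ (∂_t² H_t + (∂_t H_t)²) e^{H_t}`).
* §3 The **twist modulus** `twistModulus G J s = ∑_a J_a s_a² ⟨cos ∇θ_a⟩_J − Var_J(𝒥_s)`,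
  `𝒥_s = ∑_a J_a s_a sin ∇θ_a` the total twist current (`twistCurrent`), typed by this explicit
  second-order formula, WITH ITS READING PROVED: `t ↦ −log Z(t)` is twice differentiable and
  `twistModulus = (−log Z)''(0)` (`hasDerivAt_twistFreeEnergyDeriv_zero`,
  `iteratedDeriv_two_negLog_twistPartitionFn`) — i.e. `twistModulus = β·Υ·|Λ|`, Fisher–Barber–Jasnow's
  definition in finite volume, with no logarithm of anything but a positive real.
* §4 **The f-sum (kinetic) bound** `twistModulus ≤ ∑_a J_a s_a² ⟨cos ∇θ_a⟩_J` (the current–current term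
  is a variance; `twistModulus_le_energy`) and `≤ ∑_a J_a s_a²` for `J ≥ 0` (`twistModulus_le_sum`):
  the classical «`Υ ≤ J·⟨cos ∇θ⟩ ≤ J`»; and `⟨𝒥_s⟩_J = 0` by the inversion symmetry of the Haar measure
  (`expectJ_twistCurrent_eq_zero`), so that `twistModulus = ∑ J s² ⟨cos⟩ − ⟨𝒥_s²⟩` (`twistModulus_eq`).
* §5 The torus `(ℤ/Lℤ)²` at uniform coupling `K`: `torusXYStiffness L K = twistModulus / L²` for the
  twist along `e₁` (`= βΥ_L`), `torusXYStiffness_le_energy` (`βΥ_L ≤ K·E_L(K)`, `E_L` the bond energy of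
  `PlaneRotatorTorusBondSymmetry.lean`), `torusXYStiffness_le_coupling` (`≤ K`), and, with the
  equipartition bound `E_L(K) ≤ 8K/(1+8K)` of `PlaneRotatorEnergyRenormalizedDecay.lean`
  (`torusXYBondEnergy_le`, imported), **`βΥ_L(K) ≤ 8K²/(1 + 8K)` for every `L ≥ 3`**
  (`torusXYStiffness_le`). In temperature units (`K = J/T`): `Υ_L(T) ≤ 8J²/(T + 8J)` uniformly in `L`
  (`mul_torusXYStiffness_le`).
* §6 **Kosterlitz–Thouless corollary** (with the T1 file
  `Literature.MathematicalPhysics.StatisticalMechanics.KosterlitzThoulessStiffnessBound`): for ANY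
  stiffness profile `ρ` obeying the Kosterlitz–Thouless stability inequality `StableBelow ρ T_c`
  (`(2/π)T ≤ ρ(T)` on `(0, T_c)` — the renormalisation-group HYPOTHESIS, the only one) and dominated
  on `(0, T_c)` by the energy-class ceiling `ρ(T) ≤ 8J²/(T + 8J)` — in particular for every
  thermodynamic limit of the finite-volume moduli `T·torusXYStiffness L (J/T)` along tori `L_n ≥ 3`
  (`kt_le_of_stableBelow_of_tendsto_torusXYStiffness`) — one has
  **`T_c ≤ (√(16 + 4π) − 4)·J ≤ 1.3448·J`** (`kt_le_of_stableBelow_of_energyCeiling`, `…_decimal`),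
  against the bare-stiffness value `(π/2)·J ≤ 1.5708·J` from `Υ ≤ J` (`kt_le_pi_div_two_mul_coupling`)
  and the Monte-Carlo value `T_KT ≈ 0.893·J` [float, not used].

Reading (cell `pub/hubbard-tc`): §3–§6 are the CLASSICAL TWIN of the cell's certified chain for the
Hubbard model — f-sum ceiling on the stiffness (`Υ ≤` bond energy, here §4) × an energy ceiling
strictly below the kinematic maximum (here the equipartition theorem `8K/(1+8K) < 1`) × the
Kosterlitz–Thouless stability inequality (hypothesis) ⇒ an upper bound on `T_c` — with every link but
the last a theorem.

## Design

* The twisted Hamiltonian is written through the bond characters `χ_a(θ) = θ̄_{src a} θ_{tgt a}`: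
  `cos(∇θ_a + t s_a) = cos(t s_a) Re χ_a(θ) − sin(t s_a) Im χ_a(θ)`, so that the `t`-dependence sits in
  scalar coefficients and no angle coordinate on `U(1)` is needed; `t`-derivatives of the integrand are
  elementary and bounded uniformly on `U(1)^V`, and the parametric-integral theorem
  (`hasDerivAt_integral_of_dominated_loc_of_deriv_le`) applies with a constant dominating function.
* `twistModulus` is not normalised by a volume (a general bond system has none); the torus section
  divides by `L² = |Λ|`, the number of sites = the number of `e₁`-bonds.
* Not here: the infinite-volume limit of `Υ_L` (its existence is not claimed; §6 takes any limit as a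
  hypothesis), positivity of `Υ` at low temperature (Fröhlich–Spencer), its discontinuity (Chayes 1998),
  vortices, or any quantum model.

## References

* M. E. Fisher, M. N. Barber, D. Jasnow, Phys. Rev. A 8 (1973) 1111, §II, eqs. (2.4)–(2.5) (helicity
  modulus as the second-order free-energy response to a twist). [FisherBarberJasnow1973]
* D. R. Nelson, *Defects and Geometry in Condensed Matter Physics*, CUP 2002, §2.2.2 (stability
  `K ≥ 2/π`, eqs. (2.44)–(2.47)). [Nelson2002Defects]
* C. Garban, T. Spencer, J. Math. Phys. 63 (2022) 093302, (1.3) (bond phases). [GarbanSpencer2022]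
* M. Aizenman, B. Simon, Comm. Math. Phys. 77 (1980) 137, eq. (2.4) (the equipartition input, via the
  tree's `torusXYBondEnergy_le`). [AizenmanSimon1980LocalWard]
* J. M. Thijssen, *Computational Physics*, 2nd ed., CUP 2007, eq. (15.97) (the lattice,
  infinitesimal-twist form with periodic boundary conditions,
  `Γ = (J/2L²){⟨∑_{⟨ij⟩} cos(θ_i − θ_j)⟩ − (J/k_BT)⟨[∑_i sin(θ_i − θ_{i+ê_x})]²⟩ − (J/k_BT)⟨[∑_i sin(θ_i − θ_{i+ê_y})]²⟩}`,
  after T. Ohta, D. Jasnow, Phys. Rev. B 20 (1979) 139; our `torusXYStiffness` is `Γ/(k_BT)` for a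
  single twist direction, and «`Υ ≤ J⟨cos ∇θ⟩`» is read off (15.97) since the subtracted
  current-fluctuation terms are nonnegative — folklore in print, a theorem here). [Thijssen2007]

## What this is not

A classical comparison-model file: `Υ_L` here is the plane rotator's helicity modulus, not an electron
system's superfluid stiffness; no material number consumes it; the Kosterlitz–Thouless stability
inequality enters §6 as the HYPOTHESIS `StableBelow` exactly as in the T1 file and is not proved for
any model.

Tree: `BondSystem.expectJ`, `partitionFnJ`, `weightJ`, `torusXY`, `torusXYBondEnergy(_eq/_le)`,
`KosterlitzThouless.StableBelow`, `le_pi_div_two_mul_of_stableBelow`. Mathlib: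
`hasDerivAt_integral_of_dominated_loc_of_deriv_le`, `integral_inv_eq_self`,
`IsHaarMeasure.isInvInvariant_of_regular`.
-/

noncomputable section

open MeasureTheory Finset Filter
open scoped BigOperators Topology

namespace Literature.Probability.LatticeModels

namespace BondSystem

variable {V ι : Type*} (G : BondSystem V ι)

/-! ## §1 The twisted plane rotator -/

section Twist

variable [Fintype ι] (J s : ι → ℝ)

/-- The (negative) **twisted Hamiltonian** `H_t(θ) = ∑_a J_a cos(θ_{tgt a} − θ_{src a} + t s_a)`,
written through the bond characters: `cos(∇θ_a + t s_a) = cos(t s_a) Re χ_a(θ) − sin(t s_a) Im χ_a(θ)`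
(twist profile `s`, amplitude `t`; couplings `J_a`, inverse temperature absorbed).
[cite: FisherBarberJasnow1973, §II eqs. (2.4)–(2.5) (twisted ensemble)] -/
def twistHamiltonian (t : ℝ) (θ : V → Circle) : ℝ :=
  ∑ a, J a * (Real.cos (t * s a) * reChar (G.bondChar a) θ - Real.sin (t * s a) * imChar (G.bondChar a) θ)

/-- `∂_t H_t(θ) = −∑_a J_a s_a (sin(t s_a) Re χ_a + cos(t s_a) Im χ_a) = −∑_a J_a s_a sin(∇θ_a + t s_a)`.
[cite: FisherBarberJasnow1973, §II eqs. (2.4)–(2.5) (twisted ensemble)] -/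
def twistHamiltonianDeriv (t : ℝ) (θ : V → Circle) : ℝ :=
  -∑ a, J a * s a * (Real.sin (t * s a) * reChar (G.bondChar a) θ + Real.cos (t * s a) * imChar (G.bondChar a) θ)

/-- `∂_t² H_t(θ) = −∑_a J_a s_a² (cos(t s_a) Re χ_a − sin(t s_a) Im χ_a) = −∑_a J_a s_a² cos(∇θ_a + t s_a)`.
[cite: FisherBarberJasnow1973, §II eqs. (2.4)–(2.5) (twisted ensemble)] -/
def twistHamiltonianDeriv2 (t : ℝ) (θ : V → Circle) : ℝ :=
  -∑ a, J a * s a ^ 2 *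
    (Real.cos (t * s a) * reChar (G.bondChar a) θ - Real.sin (t * s a) * imChar (G.bondChar a) θ)

/-- The **total twist current** `𝒥_s(θ) = ∑_a J_a s_a sin(θ_{tgt a} − θ_{src a})` (so that
`∂_t H_t|_{t=0} = −𝒥_s`). [cite: FisherBarberJasnow1973, §II eqs. (2.4)–(2.5) (twisted ensemble)] -/
def twistCurrent (θ : V → Circle) : ℝ :=
  ∑ a, J a * s a * imChar (G.bondChar a) θ

/-- At zero twist the Hamiltonian is the plane-rotator Hamiltonian `∑_a J_a Re χ_a`. [cite: FisherBarberJasnow1973, §II eqs. (2.4)–(2.5) (twisted ensemble)] -/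
theorem twistHamiltonian_zero (θ : V → Circle) :
    G.twistHamiltonian J s 0 θ = ginibreHamiltonian G.bondChar J θ := by
  simp [twistHamiltonian, ginibreHamiltonian]

/-- `∂_t H_t|_{t=0} = −𝒥_s`. [cite: FisherBarberJasnow1973, §II eqs. (2.4)–(2.5) (twisted ensemble)] -/
theorem twistHamiltonianDeriv_zero (θ : V → Circle) :
    G.twistHamiltonianDeriv J s 0 θ = -G.twistCurrent J s θ := by
  simp [twistHamiltonianDeriv, twistCurrent]

/-- `∂_t² H_t|_{t=0} = −∑_a J_a s_a² Re χ_a`. [cite: FisherBarberJasnow1973, §II eqs. (2.4)–(2.5) (twisted ensemble)] -/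
theorem twistHamiltonianDeriv2_zero (θ : V → Circle) :
    G.twistHamiltonianDeriv2 J s 0 θ = -∑ a, J a * s a ^ 2 * reChar (G.bondChar a) θ := by
  simp [twistHamiltonianDeriv2]

/-- `t ↦ H_t(θ)` has derivative `∂_t H_t(θ)`. [folklore] -/
private theorem hasDerivAt_twistHamiltonian (θ : V → Circle) (t : ℝ) :
    HasDerivAt (fun t => G.twistHamiltonian J s t θ) (G.twistHamiltonianDeriv J s t θ) t := by
  unfold twistHamiltonian twistHamiltonianDeriv
  rw [← Finset.sum_neg_distrib]
  refine HasDerivAt.fun_sum fun a _ => ?_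
  have hc : HasDerivAt (fun t : ℝ => Real.cos (t * s a)) (-Real.sin (t * s a) * s a) t :=
    (hasDerivAt_mul_const (s a)).cos
  have hs : HasDerivAt (fun t : ℝ => Real.sin (t * s a)) (Real.cos (t * s a) * s a) t :=
    (hasDerivAt_mul_const (s a)).sin
  exact (((hc.mul_const (reChar (G.bondChar a) θ)).sub (hs.mul_const (imChar (G.bondChar a) θ))).const_mul
    (J a)).congr_deriv (by ring)

/-- `t ↦ ∂_t H_t(θ)` has derivative `∂_t² H_t(θ)`. [folklore] -/
private theorem hasDerivAt_twistHamiltonianDeriv (θ : V → Circle) (t : ℝ) :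
    HasDerivAt (fun t => G.twistHamiltonianDeriv J s t θ) (G.twistHamiltonianDeriv2 J s t θ) t := by
  unfold twistHamiltonianDeriv twistHamiltonianDeriv2
  refine HasDerivAt.neg ?_
  refine HasDerivAt.fun_sum fun a _ => ?_
  have hc : HasDerivAt (fun t : ℝ => Real.cos (t * s a)) (-Real.sin (t * s a) * s a) t :=
    (hasDerivAt_mul_const (s a)).cos
  have hs : HasDerivAt (fun t : ℝ => Real.sin (t * s a)) (Real.cos (t * s a) * s a) t :=
    (hasDerivAt_mul_const (s a)).sin
  exact (((hs.mul_const (reChar (G.bondChar a) θ)).add (hc.mul_const (imChar (G.bondChar a) θ))).const_mul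
    (J a * s a)).congr_deriv (by ring)

/-- The **twisted Gibbs weight** `e^{H_t(θ)} = exp(∑_a J_a cos(∇θ_a + t s_a))`. [cite: FisherBarberJasnow1973, §II eqs. (2.4)–(2.5) (twisted ensemble)] -/
def twistWeight (t : ℝ) (θ : V → Circle) : ℝ :=
  Real.exp (G.twistHamiltonian J s t θ)

/-- The twisted weight is positive. [cite: FisherBarberJasnow1973, §II eqs. (2.4)–(2.5) (twisted ensemble)] -/
theorem twistWeight_pos (t : ℝ) (θ : V → Circle) : 0 < G.twistWeight J s t θ :=
  Real.exp_pos _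

/-- At zero twist the weight is the plane-rotator weight `w_J`. [cite: FisherBarberJasnow1973, §II eqs. (2.4)–(2.5) (twisted ensemble)] -/
theorem twistWeight_zero (θ : V → Circle) : G.twistWeight J s 0 θ = G.weightJ J θ := by
  rw [twistWeight, twistHamiltonian_zero]; rfl

/-- The bond phases `u_a = e^{i t s_a} ∈ U(1)` of the twist. [cite: GarbanSpencer2022, (1.3) (bond phases)] -/
def twistPhases (t : ℝ) (a : ι) : Circle :=
  Circle.exp (t * s a)

/-- **Bridge to the disordered XY model**: the weight `exp(β ∑_a Re(u_a χ_a(θ)))` of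
`DisorderedXYModel.lean` with the bond phases `u_a = e^{its_a}` is the twisted weight at uniform
coupling `β` (`Re(e^{iα} χ) = cos α · Re χ − sin α · Im χ`). [cite: GarbanSpencer2022, (1.3) (bond phases)] -/
theorem weight_twistPhases (β t : ℝ) (θ : V → Circle) :
    G.weight β (twistPhases s t) θ = G.twistWeight (fun _ => β) s t θ := by
  simp only [weight, twistWeight, twistHamiltonian, energy, Finset.mul_sum]
  congr 1
  refine Finset.sum_congr rfl fun a _ => ?_
  rw [G.bondVar_eq_mul_bondChar, Circle.coe_mul, twistPhases, Circle.coe_exp, Complex.mul_re,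
    Complex.exp_ofReal_mul_I_re, Complex.exp_ofReal_mul_I_im]
  rfl

/-- `t ↦ e^{H_t(θ)}` has derivative `∂_t H_t · e^{H_t}`. [folklore] -/
private theorem hasDerivAt_twistWeight (θ : V → Circle) (t : ℝ) :
    HasDerivAt (fun t => G.twistWeight J s t θ)
      (G.twistHamiltonianDeriv J s t θ * G.twistWeight J s t θ) t :=
  ((G.hasDerivAt_twistHamiltonian J s θ t).exp).congr_deriv (by rw [twistWeight, mul_comm])

/-- `t ↦ ∂_t H_t · e^{H_t}` has derivative `(∂_t² H_t + (∂_t H_t)²) e^{H_t}`. [folklore] -/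
private theorem hasDerivAt_twistWeightDeriv (θ : V → Circle) (t : ℝ) :
    HasDerivAt (fun t => G.twistHamiltonianDeriv J s t θ * G.twistWeight J s t θ)
      ((G.twistHamiltonianDeriv2 J s t θ + G.twistHamiltonianDeriv J s t θ ^ 2) * G.twistWeight J s t θ) t :=
  ((G.hasDerivAt_twistHamiltonianDeriv J s θ t).mul (G.hasDerivAt_twistWeight J s θ t)).congr_deriv
    (by ring)

/-! ### Continuity in `θ` and in `(t, θ)` -/

/-- `(t, θ) ↦ H_t(θ)` is continuous. [folklore] -/
private theorem continuous_twistHamiltonian_uncurry :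
    Continuous fun p : ℝ × (V → Circle) => G.twistHamiltonian J s p.1 p.2 := by
  unfold twistHamiltonian
  refine continuous_finsetSum _ fun a _ => continuous_const.mul ?_
  exact ((Real.continuous_cos.comp (continuous_fst.mul continuous_const)).mul
    ((continuous_reChar _).comp continuous_snd)).sub
    ((Real.continuous_sin.comp (continuous_fst.mul continuous_const)).mul
    ((continuous_imChar _).comp continuous_snd))

/-- `(t, θ) ↦ ∂_t H_t(θ)` is continuous. [folklore] -/
private theorem continuous_twistHamiltonianDeriv_uncurry :
    Continuous fun p : ℝ × (V → Circle) => G.twistHamiltonianDeriv J s p.1 p.2 := by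
  unfold twistHamiltonianDeriv
  refine (continuous_finsetSum _ fun a _ => continuous_const.mul ?_).neg
  exact ((Real.continuous_sin.comp (continuous_fst.mul continuous_const)).mul
    ((continuous_reChar _).comp continuous_snd)).add
    ((Real.continuous_cos.comp (continuous_fst.mul continuous_const)).mul
    ((continuous_imChar _).comp continuous_snd))

/-- `(t, θ) ↦ ∂_t² H_t(θ)` is continuous. [folklore] -/
private theorem continuous_twistHamiltonianDeriv2_uncurry :
    Continuous fun p : ℝ × (V → Circle) => G.twistHamiltonianDeriv2 J s p.1 p.2 := by
  unfold twistHamiltonianDeriv2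
  refine (continuous_finsetSum _ fun a _ => continuous_const.mul ?_).neg
  exact ((Real.continuous_cos.comp (continuous_fst.mul continuous_const)).mul
    ((continuous_reChar _).comp continuous_snd)).sub
    ((Real.continuous_sin.comp (continuous_fst.mul continuous_const)).mul
    ((continuous_imChar _).comp continuous_snd))

/-- `(t, θ) ↦ e^{H_t(θ)}` is continuous. [folklore] -/
private theorem continuous_twistWeight_uncurry :
    Continuous fun p : ℝ × (V → Circle) => G.twistWeight J s p.1 p.2 :=
  Real.continuous_exp.comp (G.continuous_twistHamiltonian_uncurry J s)

/-- `θ ↦ H_t(θ)` is continuous. [folklore] -/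
private theorem continuous_twistHamiltonian (t : ℝ) : Continuous fun θ => G.twistHamiltonian J s t θ := by
  unfold twistHamiltonian
  exact continuous_finsetSum _ fun a _ => continuous_const.mul
    ((continuous_const.mul (continuous_reChar _)).sub (continuous_const.mul (continuous_imChar _)))

/-- `θ ↦ ∂_t H_t(θ)` is continuous. [folklore] -/
private theorem continuous_twistHamiltonianDeriv (t : ℝ) :
    Continuous fun θ => G.twistHamiltonianDeriv J s t θ := by
  unfold twistHamiltonianDeriv
  exact (continuous_finsetSum _ fun a _ => continuous_const.mul
    ((continuous_const.mul (continuous_reChar _)).add (continuous_const.mul (continuous_imChar _)))).neg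

/-- `θ ↦ ∂_t² H_t(θ)` is continuous. [folklore] -/
private theorem continuous_twistHamiltonianDeriv2 (t : ℝ) :
    Continuous fun θ => G.twistHamiltonianDeriv2 J s t θ := by
  unfold twistHamiltonianDeriv2
  exact (continuous_finsetSum _ fun a _ => continuous_const.mul
    ((continuous_const.mul (continuous_reChar _)).sub (continuous_const.mul (continuous_imChar _)))).neg

/-- `θ ↦ e^{H_t(θ)}` is continuous. [cite: FisherBarberJasnow1973, §II eqs. (2.4)–(2.5) (twisted ensemble)] -/
theorem continuous_twistWeight (t : ℝ) : Continuous fun θ => G.twistWeight J s t θ :=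
  Real.continuous_exp.comp (G.continuous_twistHamiltonian J s t)

/-- `θ ↦ 𝒥_s(θ)` is continuous. [cite: FisherBarberJasnow1973, §II eqs. (2.4)–(2.5) (twisted ensemble)] -/
theorem continuous_twistCurrent : Continuous (G.twistCurrent J s) := by
  unfold twistCurrent
  exact continuous_finsetSum _ fun a _ => continuous_const.mul (continuous_imChar _)

/-! ### Inversion symmetry `θ ↦ θ̄` -/

/-- Inversion `θ ↦ θ̄` flips the sign of the twist current: `𝒥_s(θ⁻¹) = −𝒥_s(θ)`. [cite: Thijssen2007, eq. (15.97) (periodic boundary conditions; current-fluctuation terms)] -/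
theorem twistCurrent_inv (θ : V → Circle) : G.twistCurrent J s θ⁻¹ = -G.twistCurrent J s θ := by
  unfold twistCurrent
  rw [← Finset.sum_neg_distrib]
  refine Finset.sum_congr rfl fun a _ => ?_
  rw [imChar, imChar, map_inv, Circle.coe_inv_eq_conj, Complex.conj_im]
  ring

/-- Inversion `θ ↦ θ̄` preserves the plane-rotator weight: `w_J(θ⁻¹) = w_J(θ)`. [cite: Ginibre1970, Example 4 (plane rotators cos(m·φ), even in φ)] -/
theorem weightJ_inv (θ : V → Circle) : G.weightJ J θ⁻¹ = G.weightJ J θ := by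
  rw [weightJ, weightJ, ginibreWeight, ginibreWeight, ginibreHamiltonian, ginibreHamiltonian]
  congr 1
  refine Finset.sum_congr rfl fun a _ => ?_
  rw [reChar, reChar, map_inv, Circle.coe_inv_eq_conj, Complex.conj_re]

end Twist

/-! ## §2 The twisted partition function is `C²` in the twist (differentiation under the Haar integral) -/

section PartitionFn

variable [Fintype V] [Fintype ι] [MeasurableSpace Circle] [BorelSpace Circle] (J s : ι → ℝ)

/-- The **twisted partition function** `Z(t) = ∫ exp(∑_a J_a cos(∇θ_a + t s_a)) dθ` (Haar probability
measure of `U(1)^V`). [cite: FisherBarberJasnow1973, §II eqs. (2.4)–(2.5) (twisted ensemble)] -/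
def twistPartitionFn (t : ℝ) : ℝ :=
  ∫ θ, G.twistWeight J s t θ ∂torusHaar V

/-- `Z'(t) = ∫ ∂_t H_t · e^{H_t} dθ` (proved to be the derivative in `hasDerivAt_twistPartitionFn`).
[cite: FisherBarberJasnow1973, §II eqs. (2.4)–(2.5) (twisted ensemble)] -/
def twistPartitionFnDeriv (t : ℝ) : ℝ :=
  ∫ θ, G.twistHamiltonianDeriv J s t θ * G.twistWeight J s t θ ∂torusHaar V

/-- `Z''(t) = ∫ (∂_t² H_t + (∂_t H_t)²) e^{H_t} dθ` (proved to be the second derivative in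
`hasDerivAt_twistPartitionFnDeriv`). [cite: FisherBarberJasnow1973, §II eqs. (2.4)–(2.5) (twisted ensemble)] -/
def twistPartitionFnDeriv2 (t : ℝ) : ℝ :=
  ∫ θ, (G.twistHamiltonianDeriv2 J s t θ + G.twistHamiltonianDeriv J s t θ ^ 2) *
    G.twistWeight J s t θ ∂torusHaar V

/-- At zero twist `Z(0) = Z(J)`, the plane-rotator partition function. [cite: FisherBarberJasnow1973, §II eqs. (2.4)–(2.5) (twisted ensemble)] -/
theorem twistPartitionFn_zero : G.twistPartitionFn J s 0 = G.partitionFnJ J := by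
  simp only [twistPartitionFn, twistWeight_zero, partitionFnJ]

/-- `Z(t) > 0`. [cite: FisherBarberJasnow1973, §II eqs. (2.4)–(2.5) (twisted ensemble)] -/
theorem twistPartitionFn_pos (t : ℝ) : 0 < G.twistPartitionFn J s t :=
  integral_exp_pos (integrable_torusHaar_of_continuous (G.continuous_twistWeight J s t))

/-- **First differentiation under the integral sign**: `Z` has derivative `Z'(t) = ∫ ∂_t H_t e^{H_t}`
at every `t` (the derivative of the integrand is continuous on the compact set
`closedBall t 1 × U(1)^V`, hence dominated by a constant). [cite: FisherBarberJasnow1973, §II eqs. (2.4)–(2.5) (free energy differentiable in the twist)] -/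
theorem hasDerivAt_twistPartitionFn (t₀ : ℝ) :
    HasDerivAt (G.twistPartitionFn J s) (G.twistPartitionFnDeriv J s t₀) t₀ := by
  have hF' : Continuous fun p : ℝ × (V → Circle) =>
      G.twistHamiltonianDeriv J s p.1 p.2 * G.twistWeight J s p.1 p.2 :=
    (G.continuous_twistHamiltonianDeriv_uncurry J s).mul (G.continuous_twistWeight_uncurry J s)
  have hF't : ∀ t, Continuous fun θ : V → Circle =>
      G.twistHamiltonianDeriv J s t θ * G.twistWeight J s t θ := fun t =>
    (G.continuous_twistHamiltonianDeriv J s t).mul (G.continuous_twistWeight J s t)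
  obtain ⟨C, hC⟩ := ((isCompact_closedBall t₀ 1).prod isCompact_univ).exists_bound_of_continuousOn
    hF'.continuousOn
  have h := hasDerivAt_integral_of_dominated_loc_of_deriv_le (μ := torusHaar V)
    (F := fun t θ => G.twistWeight J s t θ)
    (F' := fun t θ => G.twistHamiltonianDeriv J s t θ * G.twistWeight J s t θ) (x₀ := t₀)
    (s := Metric.ball t₀ 1) (bound := fun _ => C) (Metric.ball_mem_nhds t₀ one_pos)
    (Eventually.of_forall fun t => (G.continuous_twistWeight J s t).aestronglyMeasurable)
    (integrable_torusHaar_of_continuous (G.continuous_twistWeight J s t₀)) (hF't t₀).aestronglyMeasurable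
    (ae_of_all _ fun θ t ht => hC (t, θ) (Set.mk_mem_prod (Metric.ball_subset_closedBall ht) (Set.mem_univ θ)))
    (integrable_const C)
    (ae_of_all _ fun θ t _ => G.hasDerivAt_twistWeight J s θ t)
  exact h.2

/-- **Second differentiation under the integral sign**: `Z'` has derivative
`Z''(t) = ∫ (∂_t² H_t + (∂_t H_t)²) e^{H_t}` at every `t`. [cite: FisherBarberJasnow1973, §II eqs. (2.4)–(2.5) (free energy twice differentiable in the twist)] -/
theorem hasDerivAt_twistPartitionFnDeriv (t₀ : ℝ) :
    HasDerivAt (G.twistPartitionFnDeriv J s) (G.twistPartitionFnDeriv2 J s t₀) t₀ := by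
  have hF' : Continuous fun p : ℝ × (V → Circle) =>
      (G.twistHamiltonianDeriv2 J s p.1 p.2 + G.twistHamiltonianDeriv J s p.1 p.2 ^ 2) *
        G.twistWeight J s p.1 p.2 :=
    ((G.continuous_twistHamiltonianDeriv2_uncurry J s).add
      ((G.continuous_twistHamiltonianDeriv_uncurry J s).pow 2)).mul (G.continuous_twistWeight_uncurry J s)
  have hFt : ∀ t, Continuous fun θ : V → Circle =>
      G.twistHamiltonianDeriv J s t θ * G.twistWeight J s t θ := fun t =>
    (G.continuous_twistHamiltonianDeriv J s t).mul (G.continuous_twistWeight J s t)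
  have hF't : ∀ t, Continuous fun θ : V → Circle =>
      (G.twistHamiltonianDeriv2 J s t θ + G.twistHamiltonianDeriv J s t θ ^ 2) * G.twistWeight J s t θ :=
    fun t => ((G.continuous_twistHamiltonianDeriv2 J s t).add
      ((G.continuous_twistHamiltonianDeriv J s t).pow 2)).mul (G.continuous_twistWeight J s t)
  obtain ⟨C, hC⟩ := ((isCompact_closedBall t₀ 1).prod isCompact_univ).exists_bound_of_continuousOn
    hF'.continuousOn
  have h := hasDerivAt_integral_of_dominated_loc_of_deriv_le (μ := torusHaar V)
    (F := fun t θ => G.twistHamiltonianDeriv J s t θ * G.twistWeight J s t θ)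
    (F' := fun t θ => (G.twistHamiltonianDeriv2 J s t θ + G.twistHamiltonianDeriv J s t θ ^ 2) *
      G.twistWeight J s t θ) (x₀ := t₀)
    (s := Metric.ball t₀ 1) (bound := fun _ => C) (Metric.ball_mem_nhds t₀ one_pos)
    (Eventually.of_forall fun t => (hFt t).aestronglyMeasurable)
    (integrable_torusHaar_of_continuous (hFt t₀)) (hF't t₀).aestronglyMeasurable
    (ae_of_all _ fun θ t ht => hC (t, θ) (Set.mk_mem_prod (Metric.ball_subset_closedBall ht) (Set.mem_univ θ)))
    (integrable_const C)
    (ae_of_all _ fun θ t _ => G.hasDerivAt_twistWeightDeriv J s θ t)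
  exact h.2

/-- `deriv Z = Z'`. [cite: FisherBarberJasnow1973, §II eqs. (2.4)–(2.5) (free energy differentiable in the twist)] -/
theorem deriv_twistPartitionFn : deriv (G.twistPartitionFn J s) = G.twistPartitionFnDeriv J s :=
  funext fun t => (G.hasDerivAt_twistPartitionFn J s t).deriv

/-! ## §3 The twist modulus `(−log Z)''(0)` = `β × helicity modulus × volume` -/

/-- The first derivative of the (dimensionless) twisted free energy `−log Z(t)`:
`(−log Z)'(t) = −Z'(t)/Z(t)`. [cite: FisherBarberJasnow1973, §II eqs. (2.4)–(2.5)] -/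
def twistFreeEnergyDeriv (t : ℝ) : ℝ :=
  -G.twistPartitionFnDeriv J s t / G.twistPartitionFn J s t

/-- `t ↦ −log Z(t)` has derivative `−Z'(t)/Z(t)`. [cite: FisherBarberJasnow1973, §II eqs. (2.4)–(2.5)] -/
theorem hasDerivAt_negLog_twistPartitionFn (t : ℝ) :
    HasDerivAt (fun t => -Real.log (G.twistPartitionFn J s t)) (G.twistFreeEnergyDeriv J s t) t :=
  (((G.hasDerivAt_twistPartitionFn J s t).log (G.twistPartitionFn_pos J s t).ne').neg).congr_deriv
    (by rw [twistFreeEnergyDeriv, neg_div])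

/-- `deriv (−log Z) = −Z'/Z`. [cite: FisherBarberJasnow1973, §II eqs. (2.4)–(2.5)] -/
theorem deriv_negLog_twistPartitionFn :
    deriv (fun t => -Real.log (G.twistPartitionFn J s t)) = G.twistFreeEnergyDeriv J s :=
  funext fun t => (G.hasDerivAt_negLog_twistPartitionFn J s t).deriv

/-- `t ↦ −Z'(t)/Z(t)` has derivative `−(Z''(t) Z(t) − Z'(t) Z'(t))/Z(t)²`. [cite: FisherBarberJasnow1973, §II eqs. (2.4)–(2.5)] -/
theorem hasDerivAt_twistFreeEnergyDeriv (t : ℝ) :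
    HasDerivAt (G.twistFreeEnergyDeriv J s)
      (-((G.twistPartitionFnDeriv2 J s t * G.twistPartitionFn J s t -
          G.twistPartitionFnDeriv J s t * G.twistPartitionFnDeriv J s t) /
        G.twistPartitionFn J s t ^ 2)) t := by
  have hfun : G.twistFreeEnergyDeriv J s =
      fun t => -(G.twistPartitionFnDeriv J s t / G.twistPartitionFn J s t) := by
    funext t; rw [twistFreeEnergyDeriv, neg_div]
  rw [hfun]
  exact ((G.hasDerivAt_twistPartitionFnDeriv J s t).div (G.hasDerivAt_twistPartitionFn J s t)
    (G.twistPartitionFn_pos J s t).ne').neg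

/-- The **twist modulus** of the plane rotator with couplings `J` and twist profile `s`:
`∑_a J_a s_a² ⟨cos ∇θ_a⟩_J − (⟨𝒥_s²⟩_J − ⟨𝒥_s⟩_J²)`, `𝒥_s = ∑_a J_a s_a sin ∇θ_a` — typed by this
second-order formula and PROVED equal to `(−log Z)''(0)` (`hasDerivAt_twistFreeEnergyDeriv_zero`);
for the torus twisted along `e₁` it is `β·Υ·|Λ|` with `Υ` the helicity modulus of
Fisher–Barber–Jasnow. [cite: FisherBarberJasnow1973, §II eqs. (2.4)–(2.5) (helicity modulus)] -/
def twistModulus : ℝ :=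
  (∑ a, J a * s a ^ 2 * G.expectJ J (reChar (G.bondChar a))) -
    (G.expectJ J (fun θ => G.twistCurrent J s θ ^ 2) - G.expectJ J (G.twistCurrent J s) ^ 2)

/-- `Z'(0) = −∫ 𝒥_s w_J`. [cite: FisherBarberJasnow1973, §II eqs. (2.4)–(2.5)] -/
theorem twistPartitionFnDeriv_zero :
    G.twistPartitionFnDeriv J s 0 = -∫ θ, G.twistCurrent J s θ * G.weightJ J θ ∂torusHaar V := by
  rw [twistPartitionFnDeriv, ← integral_neg]
  refine integral_congr_ae (ae_of_all _ fun θ => ?_)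
  simp only [twistHamiltonianDeriv_zero, twistWeight_zero, neg_mul]

/-- `Z''(0) = ∫ (𝒥_s² − ∑_a J_a s_a² Re χ_a) w_J`. [cite: FisherBarberJasnow1973, §II eqs. (2.4)–(2.5)] -/
theorem twistPartitionFnDeriv2_zero :
    G.twistPartitionFnDeriv2 J s 0 =
      ∫ θ, (G.twistCurrent J s θ ^ 2 - ∑ a, J a * s a ^ 2 * reChar (G.bondChar a) θ) *
        G.weightJ J θ ∂torusHaar V := by
  rw [twistPartitionFnDeriv2]
  refine integral_congr_ae (ae_of_all _ fun θ => ?_)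
  simp only [twistHamiltonianDeriv2_zero, twistHamiltonianDeriv_zero, twistWeight_zero]
  ring

/-- The energy term as one integral: `∑_a J_a s_a² ⟨Re χ_a⟩_J = (∫ (∑_a J_a s_a² Re χ_a) w_J)/Z(J)`.
[folklore] -/
private theorem sum_expectJ_reChar_eq_integral :
    (∑ a, J a * s a ^ 2 * G.expectJ J (reChar (G.bondChar a))) =
      (∫ θ, (∑ a, J a * s a ^ 2 * reChar (G.bondChar a) θ) * G.weightJ J θ ∂torusHaar V) /
        G.partitionFnJ J := by
  have hint : ∀ a, Integrable (fun θ => reChar (G.bondChar a) θ * G.weightJ J θ) (torusHaar V) :=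
    fun a => integrable_torusHaar_of_continuous ((continuous_reChar _).mul (G.continuous_weightJ J))
  have hrhs : ∫ θ, (∑ a, J a * s a ^ 2 * reChar (G.bondChar a) θ) * G.weightJ J θ ∂torusHaar V =
      ∑ a, J a * s a ^ 2 * ∫ θ, reChar (G.bondChar a) θ * G.weightJ J θ ∂torusHaar V := by
    calc ∫ θ, (∑ a, J a * s a ^ 2 * reChar (G.bondChar a) θ) * G.weightJ J θ ∂torusHaar V
        = ∫ θ, ∑ a, J a * s a ^ 2 * (reChar (G.bondChar a) θ * G.weightJ J θ) ∂torusHaar V := by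
          refine integral_congr_ae (ae_of_all _ fun θ => ?_)
          dsimp only
          rw [Finset.sum_mul]
          exact Finset.sum_congr rfl fun a _ => by ring
      _ = ∑ a, ∫ θ, J a * s a ^ 2 * (reChar (G.bondChar a) θ * G.weightJ J θ) ∂torusHaar V :=
          integral_finsetSum _ fun a _ => (hint a).const_mul _
      _ = ∑ a, J a * s a ^ 2 * ∫ θ, reChar (G.bondChar a) θ * G.weightJ J θ ∂torusHaar V :=
          Finset.sum_congr rfl fun a _ => integral_const_mul _ _
  rw [hrhs, Finset.sum_div]
  refine Finset.sum_congr rfl fun a _ => ?_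
  rw [expectJ_eq, mul_div_assoc]

/-- **Fisher–Barber–Jasnow's reading, proved**: the second derivative of `−log Z(t)` at `t = 0` is the
twist modulus, `(−log Z)''(0) = ∑_a J_a s_a² ⟨cos ∇θ_a⟩_J − Var_J(𝒥_s)`.
[cite: FisherBarberJasnow1973, §II eqs. (2.4)–(2.5) (helicity modulus)] -/
theorem hasDerivAt_twistFreeEnergyDeriv_zero :
    HasDerivAt (G.twistFreeEnergyDeriv J s) (G.twistModulus J s) 0 := by
  refine (G.hasDerivAt_twistFreeEnergyDeriv J s 0).congr_deriv ?_
  have hZ := G.partitionFnJ_pos J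
  rw [twistPartitionFn_zero, twistPartitionFnDeriv_zero, twistPartitionFnDeriv2_zero, twistModulus,
    sum_expectJ_reChar_eq_integral, expectJ_eq, expectJ_eq]
  have hsplit : ∫ θ, (G.twistCurrent J s θ ^ 2 - ∑ a, J a * s a ^ 2 * reChar (G.bondChar a) θ) *
        G.weightJ J θ ∂torusHaar V =
      (∫ θ, G.twistCurrent J s θ ^ 2 * G.weightJ J θ ∂torusHaar V) -
        ∫ θ, (∑ a, J a * s a ^ 2 * reChar (G.bondChar a) θ) * G.weightJ J θ ∂torusHaar V := by
    rw [← integral_sub]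
    · refine integral_congr_ae (ae_of_all _ fun θ => ?_); ring
    · exact integrable_torusHaar_of_continuous
        (((G.continuous_twistCurrent J s).pow 2).mul (G.continuous_weightJ J))
    · exact integrable_torusHaar_of_continuous
        ((continuous_finsetSum _ fun a _ => continuous_const.mul (continuous_reChar _)).mul
          (G.continuous_weightJ J))
  rw [hsplit, partitionFnJ]
  field_simp
  ring

/-- The same as `iteratedDeriv 2 (−log Z) 0 = twistModulus`. [cite: FisherBarberJasnow1973, §II eqs. (2.4)–(2.5) (helicity modulus)] -/
theorem iteratedDeriv_two_negLog_twistPartitionFn :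
    iteratedDeriv 2 (fun t => -Real.log (G.twistPartitionFn J s t)) 0 = G.twistModulus J s := by
  rw [show (2 : ℕ) = 1 + 1 from rfl, iteratedDeriv_succ, iteratedDeriv_one, deriv_negLog_twistPartitionFn]
  exact (G.hasDerivAt_twistFreeEnergyDeriv_zero J s).deriv

/-! ## §4 The f-sum bound `Υ ≤ J·⟨cos ∇θ⟩` and the symmetry `⟨𝒥_s⟩ = 0` -/

/-- The variance of the twist current is nonnegative: `⟨𝒥_s⟩_J² ≤ ⟨𝒥_s²⟩_J`. [cite: Thijssen2007, eq. (15.97) (periodic boundary conditions; current-fluctuation terms)] -/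
theorem expectJ_twistCurrent_sq_le :
    G.expectJ J (G.twistCurrent J s) ^ 2 ≤ G.expectJ J (fun θ => G.twistCurrent J s θ ^ 2) := by
  have hZ := G.partitionFnJ_pos J
  have hcont := G.continuous_twistCurrent J s
  have hw := G.continuous_weightJ J
  set Z := G.partitionFnJ J with hZdef
  set A := ∫ θ, G.twistCurrent J s θ * G.weightJ J θ ∂torusHaar V with hA
  set B := ∫ θ, G.twistCurrent J s θ ^ 2 * G.weightJ J θ ∂torusHaar V with hB
  have h1 : Integrable (fun θ => G.twistCurrent J s θ ^ 2 * G.weightJ J θ) (torusHaar V) :=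
    integrable_torusHaar_of_continuous ((hcont.pow 2).mul hw)
  have h2 : Integrable (fun θ => G.twistCurrent J s θ * G.weightJ J θ) (torusHaar V) :=
    integrable_torusHaar_of_continuous (hcont.mul hw)
  have h3 : Integrable (G.weightJ J) (torusHaar V) := G.integrable_weightJ J
  -- `0 ≤ ∫ (Z·𝒥 − A)² w = Z² B − 2 Z A² + A² Z = Z (Z B − A²)`
  have hnn : 0 ≤ ∫ θ, (Z * G.twistCurrent J s θ - A) ^ 2 * G.weightJ J θ ∂torusHaar V :=
    integral_nonneg fun θ => mul_nonneg (sq_nonneg _) (G.weightJ_pos J θ).le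
  have hexp : ∫ θ, (Z * G.twistCurrent J s θ - A) ^ 2 * G.weightJ J θ ∂torusHaar V =
      Z ^ 2 * B - 2 * Z * A * A + A ^ 2 * Z := by
    have e1 : ∫ θ, (Z * G.twistCurrent J s θ - A) ^ 2 * G.weightJ J θ ∂torusHaar V =
        ∫ θ, (Z ^ 2 * (G.twistCurrent J s θ ^ 2 * G.weightJ J θ) -
          2 * Z * A * (G.twistCurrent J s θ * G.weightJ J θ)) + A ^ 2 * G.weightJ J θ ∂torusHaar V :=
      integral_congr_ae (ae_of_all _ fun θ => by ring)
    have e2 : ∫ θ, Z ^ 2 * (G.twistCurrent J s θ ^ 2 * G.weightJ J θ) -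
          2 * Z * A * (G.twistCurrent J s θ * G.weightJ J θ) + A ^ 2 * G.weightJ J θ ∂torusHaar V =
        (∫ θ, Z ^ 2 * (G.twistCurrent J s θ ^ 2 * G.weightJ J θ) -
          2 * Z * A * (G.twistCurrent J s θ * G.weightJ J θ) ∂torusHaar V) +
          ∫ θ, A ^ 2 * G.weightJ J θ ∂torusHaar V :=
      integral_add ((h1.const_mul _).sub (h2.const_mul _)) (h3.const_mul _)
    have e3 : ∫ θ, Z ^ 2 * (G.twistCurrent J s θ ^ 2 * G.weightJ J θ) -
          2 * Z * A * (G.twistCurrent J s θ * G.weightJ J θ) ∂torusHaar V =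
        (∫ θ, Z ^ 2 * (G.twistCurrent J s θ ^ 2 * G.weightJ J θ) ∂torusHaar V) -
          ∫ θ, 2 * Z * A * (G.twistCurrent J s θ * G.weightJ J θ) ∂torusHaar V :=
      integral_sub (h1.const_mul _) (h2.const_mul _)
    have hZint : ∫ θ, G.weightJ J θ ∂torusHaar V = Z := by rw [hZdef]; rfl
    rw [e1, e2, e3, integral_const_mul, integral_const_mul, integral_const_mul, ← hA, ← hB, hZint]
  have key : A ^ 2 ≤ B * Z := by nlinarith [hnn, hexp, hZ]
  rw [expectJ_eq, expectJ_eq, ← hA, ← hB, ← hZdef, div_pow, div_le_div_iff₀ (pow_pos hZ 2) hZ]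
  nlinarith [key, hZ]

/-- **The f-sum bound on the twist modulus**: `(−log Z)''(0) ≤ ∑_a J_a s_a² ⟨cos(θ_{tgt a} − θ_{src a})⟩_J`
— the helicity modulus is at most the twist-weighted bond energy (the current–current correction is a
variance). For the torus: `Υ ≤ J·⟨cos ∇θ⟩`. [cite: FisherBarberJasnow1973, §II eqs. (2.4)–(2.5) (helicity modulus)] -/
theorem twistModulus_le_energy :
    G.twistModulus J s ≤ ∑ a, J a * s a ^ 2 * G.expectJ J (reChar (G.bondChar a)) := by
  have := G.expectJ_twistCurrent_sq_le J s
  rw [twistModulus]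
  linarith

/-- `(−log Z)''(0) ≤ ∑_a J_a s_a²` for ferromagnetic couplings `J ≥ 0` (`⟨cos ∇θ_a⟩ ≤ 1`): for the
torus, `Υ ≤ J`. [cite: FisherBarberJasnow1973, §II eqs. (2.4)–(2.5) (helicity modulus)] -/
theorem twistModulus_le_sum {J : ι → ℝ} (hJ : ∀ a, 0 ≤ J a) (s : ι → ℝ) :
    G.twistModulus J s ≤ ∑ a, J a * s a ^ 2 := by
  refine (G.twistModulus_le_energy J s).trans (Finset.sum_le_sum fun a _ => ?_)
  have := G.expectJ_reChar_bondChar_le_one J a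
  have h0 : 0 ≤ J a * s a ^ 2 := mul_nonneg (hJ a) (sq_nonneg _)
  nlinarith

/-- **The mean twist current vanishes**: `⟨𝒥_s⟩_J = 0` (the Haar measure of the abelian compact group
`U(1)^V` is inversion invariant, the weight is even and the current odd under `θ ↦ θ̄`). [cite: Thijssen2007, eq. (15.97) (periodic boundary conditions; current-fluctuation terms)] -/
theorem expectJ_twistCurrent_eq_zero : G.expectJ J (G.twistCurrent J s) = 0 := by
  rw [expectJ_eq, div_eq_zero_iff]
  left
  haveI : (torusHaar V).IsInvInvariant := by unfold torusHaar; infer_instance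
  have h := integral_inv_eq_self (fun θ => G.twistCurrent J s θ * G.weightJ J θ) (torusHaar V)
  simp only [twistCurrent_inv, weightJ_inv, neg_mul, integral_neg] at h
  linarith

/-- Hence `(−log Z)''(0) = ∑_a J_a s_a² ⟨cos ∇θ_a⟩_J − ⟨𝒥_s²⟩_J`. [cite: FisherBarberJasnow1973, §II eqs. (2.4)–(2.5) (helicity modulus)] -/
theorem twistModulus_eq :
    G.twistModulus J s =
      (∑ a, J a * s a ^ 2 * G.expectJ J (reChar (G.bondChar a))) -
        G.expectJ J (fun θ => G.twistCurrent J s θ ^ 2) := by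
  rw [twistModulus, expectJ_twistCurrent_eq_zero]; ring

end PartitionFn

end BondSystem

/-! ## §5 The torus `(ℤ/Lℤ)²`: `βΥ_L(K) ≤ K·E_L(K) ≤ 8K²/(1 + 8K)` -/

section Torus

variable {L : ℕ}

/-- The **twist profile along `e₁`** on the bonds `(z, i) : z → z + eᵢ` of `(ℤ/Lℤ)²`: `1` on the
bonds in direction `e₁` (`i = 0`), `0` on the others — a uniform phase gradient per lattice spacing
along `e₁`. [cite: FisherBarberJasnow1973, §II eqs. (2.3)–(2.5) (uniform twist)] -/
def torusTwistProfile (L : ℕ) (b : TorusSite 2 L × Fin 2) : ℝ :=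
  if b.2 = 0 then 1 else 0

variable [NeZero L]

/-- `∑_b s_b² = |Λ| = L²`: one `e₁`-bond per site. [folklore] -/
private theorem sum_torusTwistProfile_sq :
    ∑ b : TorusSite 2 L × Fin 2, torusTwistProfile L b ^ 2 = Fintype.card (TorusSite 2 L) := by
  rw [Fintype.sum_prod_type]
  have h : ∀ z : TorusSite 2 L, ∑ i : Fin 2, torusTwistProfile L (z, i) ^ 2 = 1 := fun z => by
    simp [torusTwistProfile]
  simp only [h, Finset.sum_const, Finset.card_univ, nsmul_eq_mul, mul_one]

variable [MeasurableSpace Circle] [BorelSpace Circle]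

/-- The **reduced helicity modulus** `βΥ_L(K)` of the nearest-neighbour plane rotator on `(ℤ/Lℤ)²`
at uniform coupling `K = βJ`: the twist modulus for the twist along `e₁`, per site,
`(−log Z)''(0)/L² = K⟨cos ∇θ⟩ − (K²/L²)⟨(∑_{e₁-bonds} sin ∇θ)²⟩` (Thijssen, *Computational Physics*,
eq. (15.97), after Ohta–Jasnow 1979: `Γ/(k_B T)` for one twist direction).
[cite: FisherBarberJasnow1973, §II eqs. (2.4)–(2.5) (helicity modulus)] -/
def torusXYStiffness (L : ℕ) [NeZero L] (K : ℝ) : ℝ :=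
  (torusXY 2 L).twistModulus (fun _ => K) (torusTwistProfile L) / (Fintype.card (TorusSite 2 L) : ℝ)

/-- **`βΥ_L(K) ≤ K·E_L(K)`** — the f-sum bound on the torus: the reduced helicity modulus is at most
the coupling times the nearest-neighbour bond energy `E_L(K) = ⟨cos(θ_{z+eᵢ} − θ_z)⟩_{K,L}` (any bond
`b₀`; all bond energies coincide, `torusXYBondEnergy_eq`). [cite: FisherBarberJasnow1973, §II eqs. (2.4)–(2.5) (helicity modulus)] -/
theorem torusXYStiffness_le_energy (K : ℝ) (b₀ : TorusSite 2 L × Fin 2) :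
    torusXYStiffness L K ≤ K * torusXYBondEnergy L K b₀ := by
  have hcard : (0 : ℝ) < Fintype.card (TorusSite 2 L) := Nat.cast_pos.2 Fintype.card_pos
  rw [torusXYStiffness, div_le_iff₀ hcard]
  refine ((torusXY 2 L).twistModulus_le_energy _ _).trans (le_of_eq ?_)
  have hE : ∀ b, (torusXY 2 L).expectJ (fun _ => K) (reChar ((torusXY 2 L).bondChar b)) =
      torusXYBondEnergy L K b₀ := fun b => by
    rw [torusXY_expectJ_reChar_bondChar, torusXYBondEnergy_eq K b b₀]
  calc ∑ b, K * torusTwistProfile L b ^ 2 * (torusXY 2 L).expectJ (fun _ => K)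
          (reChar ((torusXY 2 L).bondChar b))
      = ∑ b, K * torusXYBondEnergy L K b₀ * torusTwistProfile L b ^ 2 :=
        Finset.sum_congr rfl fun b _ => by rw [hE b]; ring
    _ = K * torusXYBondEnergy L K b₀ * Fintype.card (TorusSite 2 L) := by
        rw [← Finset.mul_sum, sum_torusTwistProfile_sq]

/-- **`βΥ_L(K) ≤ K`** for `K ≥ 0` (the bare bound `Υ ≤ J`). [cite: FisherBarberJasnow1973, §II eqs. (2.4)–(2.5) (helicity modulus)] -/
theorem torusXYStiffness_le_coupling {K : ℝ} (hK : 0 ≤ K) : torusXYStiffness L K ≤ K := by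
  refine (torusXYStiffness_le_energy K (0, 0)).trans ?_
  have h1 : torusXYBondEnergy L K (0, 0) ≤ 1 := (torusXY 2 L).expectJ_reChar_bondChar_le_one _ _
  nlinarith

/-- **The energy-renormalised stiffness ceiling `βΥ_L(K) ≤ 8K²/(1 + 8K)`**, for every `L ≥ 3` and
`K > 0`: the f-sum bound combined with the equipartition bound `E_L(K) ≤ 8K/(1 + 8K)` on the bond
energy (`torusXYBondEnergy_le`, Aizenman–Simon local Ward identity). Uniform in the volume.
[cite: AizenmanSimon1980LocalWard, eq. (2.4) (equipartition input); FisherBarberJasnow1973 §II] -/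
theorem torusXYStiffness_le (hL : 3 ≤ L) {K : ℝ} (hK : 0 < K) :
    torusXYStiffness L K ≤ 8 * K ^ 2 / (1 + 8 * K) := by
  refine (torusXYStiffness_le_energy K (0, 0)).trans ?_
  have h := mul_le_mul_of_nonneg_left (torusXYBondEnergy_le hL hK (0, 0)) hK.le
  calc K * torusXYBondEnergy L K (0, 0) ≤ K * (8 * K / (1 + 8 * K)) := h
    _ = 8 * K ^ 2 / (1 + 8 * K) := by ring

/-- The same in temperature units: with `K = J/T` (`J > 0` the coupling, `T > 0` the temperature),
the finite-volume helicity modulus `Υ_L(T) = T·βΥ_L` obeys **`Υ_L(T) ≤ 8J²/(T + 8J)`** for every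
`L ≥ 3`. [cite: AizenmanSimon1980LocalWard, eq. (2.4) (equipartition input); FisherBarberJasnow1973 §II] -/
theorem mul_torusXYStiffness_le (hL : 3 ≤ L) {J T : ℝ} (hJ : 0 < J) (hT : 0 < T) :
    T * torusXYStiffness L (J / T) ≤ 8 * J ^ 2 / (T + 8 * J) := by
  have hK : 0 < J / T := div_pos hJ hT
  have h := mul_le_mul_of_nonneg_left (torusXYStiffness_le hL hK) hT.le
  refine h.trans (le_of_eq ?_)
  field_simp

end Torus

/-! ## §6 The energy-renormalised Kosterlitz–Thouless bound `T_c ≤ (√(16 + 4π) − 4)·J` -/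

section KosterlitzThouless

open Literature.MathematicalPhysics.StatisticalMechanics.KosterlitzThouless

/-- **Energy-renormalised Kosterlitz–Thouless bound.** Let `ρ` be a stiffness profile (energy units)
obeying the Kosterlitz–Thouless stability inequality `StableBelow ρ T_c` (`(2/π)T ≤ ρ(T)` for
`0 < T < T_c` — the renormalisation-group HYPOTHESIS of Nelson 2002 §2.2.2) with `T_c > 0`, and
dominated on `(0, T_c)` by the energy-class ceiling of the two-dimensional XY model with coupling
`J > 0`, `ρ(T) ≤ 8J²/(T + 8J)` (as every thermodynamic limit of the finite-volume helicity moduli is,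
`mul_torusXYStiffness_le`). Then **`T_c ≤ (√(16 + 4π) − 4)·J ≈ 1.3448·J`** — against `(π/2)·J ≈ 1.5708·J`
from the bare bound `ρ ≤ J` (`kt_le_pi_div_two_mul_coupling`); the Monte-Carlo value of the XY
transition is `T_KT ≈ 0.893·J` [float, not used]. Proof: `(2/π)T ≤ 8J²/(T + 8J)` on `(0, T_c)` gives
`T(T + 8J) ≤ 4πJ²` there, hence at `T_c` by continuity, i.e. `(T_c + 4J)² ≤ (16 + 4π)J²`.
[cite: Nelson2002Defects, §2.2.2 eqs. (2.44)–(2.47) (stability inequality, consumed as hypothesis)] -/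
theorem kt_le_of_stableBelow_of_energyCeiling {ρ : ℝ → ℝ} {Tc J : ℝ} (hJ : 0 < J) (hTc : 0 < Tc)
    (hst : StableBelow ρ Tc) (hceil : ∀ ⦃T : ℝ⦄, 0 < T → T < Tc → ρ T ≤ 8 * J ^ 2 / (T + 8 * J)) :
    Tc ≤ (Real.sqrt (16 + 4 * Real.pi) - 4) * J := by
  -- on `(0, Tc)`: `T (T + 8J) ≤ 4π J²`
  have hpoly : ∀ ⦃T : ℝ⦄, 0 < T → T < Tc → T * (T + 8 * J) ≤ 4 * Real.pi * J ^ 2 := by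
    intro T hT hTlt
    have hpos : 0 < T + 8 * J := by linarith
    have h : 2 / Real.pi * T ≤ 8 * J ^ 2 / (T + 8 * J) := (hst hT hTlt).trans (hceil hT hTlt)
    rw [div_mul_eq_mul_div, div_le_div_iff₀ Real.pi_pos hpos] at h
    nlinarith [h, Real.pi_pos]
  -- pass to the limit `T → Tc⁻`
  have hlim : Tc * (Tc + 8 * J) ≤ 4 * Real.pi * J ^ 2 := by
    have hcont : Tendsto (fun T : ℝ => T * (T + 8 * J)) (𝓝[<] Tc) (𝓝 (Tc * (Tc + 8 * J))) :=
      ((continuous_id.mul (continuous_id.add continuous_const)).tendsto Tc).mono_left nhdsWithin_le_nhds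
    refine le_of_tendsto hcont ?_
    filter_upwards [Ioo_mem_nhdsLT hTc] with T hT using hpoly hT.1 hT.2
  -- algebra
  have hsq : (Tc + 4 * J) ^ 2 ≤ (16 + 4 * Real.pi) * J ^ 2 := by nlinarith [hlim]
  have hJ4 : 0 ≤ Tc + 4 * J := by linarith
  have h16 : (0 : ℝ) ≤ 16 + 4 * Real.pi := by positivity
  have h := Real.sqrt_le_sqrt hsq
  rw [Real.sqrt_sq hJ4, Real.sqrt_mul h16, Real.sqrt_sq hJ.le] at h
  linarith

/-- Decimal form: under the hypotheses of `kt_le_of_stableBelow_of_energyCeiling`,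
**`T_c ≤ 1.3448·J`** (`√(16 + 4π) − 4 = 1.34475… < π/2 = 1.57079…`, via `π < 3.1416`).
[cite: Nelson2002Defects, §2.2.2 eqs. (2.44)–(2.47) (stability inequality, consumed as hypothesis)] -/
theorem kt_le_of_stableBelow_of_energyCeiling_decimal {ρ : ℝ → ℝ} {Tc J : ℝ} (hJ : 0 < J)
    (hTc : 0 < Tc) (hst : StableBelow ρ Tc)
    (hceil : ∀ ⦃T : ℝ⦄, 0 < T → T < Tc → ρ T ≤ 8 * J ^ 2 / (T + 8 * J)) :
    Tc ≤ 1.3448 * J := by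
  have h := kt_le_of_stableBelow_of_energyCeiling hJ hTc hst hceil
  have hsqrt : Real.sqrt (16 + 4 * Real.pi) ≤ 5.3448 := by
    rw [show (5.3448 : ℝ) = Real.sqrt (5.3448 ^ 2) by rw [Real.sqrt_sq (by norm_num)]]
    exact Real.sqrt_le_sqrt (by nlinarith [Real.pi_lt_d4])
  nlinarith [h, hsqrt]

/-- **The bound from finite-volume helicity moduli.** If the stiffness profile `ρ` is, at every
temperature `0 < T < T_c`, the limit of the finite-volume helicity moduli `Υ_{L_n}(T) =
T·βΥ_{L_n}(J/T)` of the XY model on tori `(ℤ/L_nℤ)²`, `L_n ≥ 3` (any sequence — existence of the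
thermodynamic limit is the hypothesis, not a claim), and obeys the Kosterlitz–Thouless stability
inequality below `T_c > 0`, then `T_c ≤ (√(16 + 4π) − 4)·J`.
[cite: Nelson2002Defects, §2.2.2 eqs. (2.44)–(2.47) (stability inequality, consumed as hypothesis)] -/
theorem kt_le_of_stableBelow_of_tendsto_torusXYStiffness [MeasurableSpace Circle] [BorelSpace Circle]
    {ρ : ℝ → ℝ} {Tc J : ℝ} (hJ : 0 < J) (hTc : 0 < Tc) (hst : StableBelow ρ Tc)
    (Ls : ℕ → ℕ) [∀ n, NeZero (Ls n)] (hLs : ∀ n, 3 ≤ Ls n)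
    (hlim : ∀ ⦃T : ℝ⦄, 0 < T → T < Tc →
      Tendsto (fun n => T * torusXYStiffness (Ls n) (J / T)) atTop (𝓝 (ρ T))) :
    Tc ≤ (Real.sqrt (16 + 4 * Real.pi) - 4) * J :=
  kt_le_of_stableBelow_of_energyCeiling hJ hTc hst fun _ hT hTlt =>
    le_of_tendsto' (hlim hT hTlt) fun n => mul_torusXYStiffness_le (hLs n) hJ hT

/-- For comparison, **the bare bound `T_c ≤ (π/2)·J`**: a profile obeying the stability inequality
below `T_c > 0` and the bare ceiling `ρ(T) ≤ J` on `(0, T_c)` (`Υ ≤ J`, `torusXYStiffness_le_coupling`)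
has `T_c ≤ (π/2)·J ≈ 1.5708·J` (the T1 file's `le_pi_div_two_mul_of_stableBelow` with `ρ̄ = J`).
[cite: Nelson2002Defects, §2.2.2 eqs. (2.44)–(2.47) (stability inequality, consumed as hypothesis)] -/
theorem kt_le_pi_div_two_mul_coupling {ρ : ℝ → ℝ} {Tc J : ℝ} (hTc : 0 < Tc) (hst : StableBelow ρ Tc)
    (hceil : ∀ ⦃T : ℝ⦄, 0 < T → T < Tc → ρ T ≤ J) : Tc ≤ Real.pi / 2 * J :=
  le_pi_div_two_mul_of_stableBelow hst hTc hceil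

end KosterlitzThouless

end Literature.Probability.LatticeModels
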